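import Summits.PneNP.PneNP.Theorems.SymmetryBudgetWindowCanoniserDagDefs

/-!
# Window canoniser, IX: how relabelling acts on the builders

Route `PneNP/SymmetryBudget`, dichotomy `WindowBarrier` (stmt-PneNP-2145) / `NoHiddenOrder` (stmt-PneNP-14781);
continuation of `…WindowCanoniserDagDefs.lean`.  `simp` lemmas computing `Atom.act π` / `N1.act π` / `N2.act π`
on every builder of the wiring (parameter records, vertex tuples, formula formers, atom builders, child labels,
lifted bits): relabelling renames the label and the vertex parameters and fixes everything else.  Used by the
symmetry proof (`…Symmetry.lean`).
-/

-- `Summit.PneNP.PneNP.…` duplicates `PneNP` BY DESIGN (single-problem summit, D-0017 layout).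
set_option linter.dupNamespace false

noncomputable section

namespace Summit.PneNP.PneNP.Theorems

namespace WCan

open Finset Equiv Literature.Computability.Complexity

variable {K r n : ℕ} (π : Perm (Fin n))

/-! ### Records and tuples -/

/-- `prm_act`: bookkeeping/simp lemma (prm act). -/
theorem prm_act [NeZero n] (vs : Fin 5 → Fin n) (it : Fin (T n + 1)) (rd s : Fin (n + 1)) (ns : Fin 3 → Fin n) (h1 h2 : Fin (n + 1))
    (o1 o2 : Option (Fin r)) (us : Finset (Fin n)) (fl : Bool) (b : Fin (NB r n + 1)) (bp : Fin (NBp r n + 1)) :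
    (prm vs (it := it) (rd := rd) (s := s) (ns := ns) (h1 := h1) (h2 := h2) (o1 := o1) (o2 := o2) (us := us) (fl := fl)
      (b := b) (bp := bp) : Prm r n).act π =
    prm (fun i => π (vs i)) (it := it) (rd := rd) (s := s) (ns := ns) (h1 := h1) (h2 := h2) (o1 := o1) (o2 := o2)
      (us := us.map π.toEmbedding) (fl := fl) (b := b) (bp := bp) := rfl

/-- `comp_vec2`: bookkeeping/simp lemma (comp vec2). -/
theorem comp_vec2 (u v : Fin n) : (fun i => π (vec2 u v i)) = vec2 (π u) (π v) := by
  funext i; unfold vec2; split_ifs <;> rfl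
/-- `comp_vec3`: bookkeeping/simp lemma (comp vec3). -/
theorem comp_vec3 (u v w : Fin n) : (fun i => π (vec3 u v w i)) = vec3 (π u) (π v) (π w) := by
  funext i; unfold vec3; split_ifs <;> rfl
/-- `comp_vec4`: bookkeeping/simp lemma (comp vec4). -/
theorem comp_vec4 (u v w y : Fin n) : (fun i => π (vec4 u v w y i)) = vec4 (π u) (π v) (π w) (π y) := by
  funext i; unfold vec4; split_ifs <;> rfl

section PrmVec

variable [NeZero n] (it : Fin (T n + 1)) (rd s : Fin (n + 1)) (ns : Fin 3 → Fin n) (h1 h2 : Fin (n + 1))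
    (o1 o2 : Option (Fin r)) (us : Finset (Fin n)) (fl : Bool) (b : Fin (NB r n + 1)) (bp : Fin (NBp r n + 1))

/-- `prm_act_vec1`: bookkeeping/simp lemma (prm act vec1). -/
@[simp] theorem prm_act_vec1 (u : Fin n) :
    (prm (vec1 u) (it := it) (rd := rd) (s := s) (ns := ns) (h1 := h1) (h2 := h2) (o1 := o1) (o2 := o2) (us := us)
      (fl := fl) (b := b) (bp := bp) : Prm r n).act π =
    prm (vec1 (π u)) (it := it) (rd := rd) (s := s) (ns := ns) (h1 := h1) (h2 := h2) (o1 := o1) (o2 := o2)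
      (us := us.map π.toEmbedding) (fl := fl) (b := b) (bp := bp) := rfl

/-- `prm_act_vec2`: bookkeeping/simp lemma (prm act vec2). -/
@[simp] theorem prm_act_vec2 (u v : Fin n) :
    (prm (vec2 u v) (it := it) (rd := rd) (s := s) (ns := ns) (h1 := h1) (h2 := h2) (o1 := o1) (o2 := o2) (us := us)
      (fl := fl) (b := b) (bp := bp) : Prm r n).act π =
    prm (vec2 (π u) (π v)) (it := it) (rd := rd) (s := s) (ns := ns) (h1 := h1) (h2 := h2) (o1 := o1) (o2 := o2)
      (us := us.map π.toEmbedding) (fl := fl) (b := b) (bp := bp) := by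
  rw [prm_act, comp_vec2]

/-- `prm_act_vec3`: bookkeeping/simp lemma (prm act vec3). -/
@[simp] theorem prm_act_vec3 (u v w : Fin n) :
    (prm (vec3 u v w) (it := it) (rd := rd) (s := s) (ns := ns) (h1 := h1) (h2 := h2) (o1 := o1) (o2 := o2) (us := us)
      (fl := fl) (b := b) (bp := bp) : Prm r n).act π =
    prm (vec3 (π u) (π v) (π w)) (it := it) (rd := rd) (s := s) (ns := ns) (h1 := h1) (h2 := h2) (o1 := o1) (o2 := o2)
      (us := us.map π.toEmbedding) (fl := fl) (b := b) (bp := bp) := by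
  rw [prm_act, comp_vec3]

/-- `prm_act_vec4`: bookkeeping/simp lemma (prm act vec4). -/
@[simp] theorem prm_act_vec4 (u v w y : Fin n) :
    (prm (vec4 u v w y) (it := it) (rd := rd) (s := s) (ns := ns) (h1 := h1) (h2 := h2) (o1 := o1) (o2 := o2) (us := us)
      (fl := fl) (b := b) (bp := bp) : Prm r n).act π =
    prm (vec4 (π u) (π v) (π w) (π y)) (it := it) (rd := rd) (s := s) (ns := ns) (h1 := h1) (h2 := h2) (o1 := o1)
      (o2 := o2) (us := us.map π.toEmbedding) (fl := fl) (b := b) (bp := bp) := by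
  rw [prm_act, comp_vec4]

end PrmVec

/-- The general form of the action on records. -/
theorem prm_act' (P : Prm r n) : P.act π = { P with vs := fun i => π (P.vs i), us := P.us.map π.toEmbedding } := rfl

/-- The action on a record literal. -/
@[simp] theorem Prm.act_mk (it : Fin (T n + 1)) (rd s : Fin (n + 1)) (vs : Fin 5 → Fin n) (ns : Fin 3 → Fin n)
    (h1 h2 : Fin (n + 1)) (o1 o2 : Option (Fin r)) (us : Finset (Fin n)) (fl : Bool) (b : Fin (NB r n + 1))
    (bp : Fin (NBp r n + 1)) :
    (⟨it, rd, s, vs, ns, h1, h2, o1, o2, us, fl, b, bp⟩ : Prm r n).act π =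
      ⟨it, rd, s, fun i => π (vs i), ns, h1, h2, o1, o2, us.map π.toEmbedding, fl, b, bp⟩ := rfl

/-- The vertex slots of a relabelled record, as a function. -/
@[simp] theorem Prm.act_vs_fun (P : Prm r n) : (P.act π).vs = fun i => π (P.vs i) := rfl

/-- Updating the iteration slot commutes with the action. -/
@[simp] theorem Prm.act_set_it (P : Prm r n) (it : Fin (T n + 1)) : ({ P with it := it } : Prm r n).act π = { P.act π with it := it } := rfl

/-- `act_ttA`: bookkeeping/simp lemma (act ttA). -/
@[simp] theorem act_ttA : (ttA : Atom K r n).act π = ttA := rfl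
/-- `act_ffA`: bookkeeping/simp lemma (act ffA). -/
@[simp] theorem act_ffA : (ffA : Atom K r n).act π = ffA := rfl

/-! ### Formula formers -/

/-- Relabelling a literal. -/
abbrev litAct (l : Lit K r n) : Lit K r n := (l.1.act π, l.2)

/-- `litAct_pos`: bookkeeping/simp lemma (litAct pos). -/
@[simp] theorem litAct_pos (a : Atom K r n) : litAct π (pos a) = pos (a.act π) := rfl
/-- `litAct_neg`: bookkeeping/simp lemma (litAct neg). -/
@[simp] theorem litAct_neg (a : Atom K r n) : litAct π (neg a) = neg (a.act π) := rfl

/-- `act_eq`: bookkeeping/simp lemma (act eq). -/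
theorem N1.act_eq (f : N1 K r n) : f.act π = ⟨f.isAnd, fun i => litAct π (f.ls i)⟩ := rfl

/-- `act_n1and`: bookkeeping/simp lemma (act n1and). -/
@[simp] theorem act_n1and (ls : List (Lit K r n)) : (n1and ls).act π = n1and (ls.map (litAct π)) := by
  simp only [n1and, N1.act_eq, N1.mk.injEq, true_and]
  funext i
  rw [List.getD_eq_getElem?_getD, List.getD_eq_getElem?_getD, List.getElem?_map]
  cases ls[(i : ℕ)]? <;> rfl

/-- `act_n1or`: bookkeeping/simp lemma (act n1or). -/
@[simp] theorem act_n1or (ls : List (Lit K r n)) : (n1or ls).act π = n1or (ls.map (litAct π)) := by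
  simp only [n1or, N1.act_eq, N1.mk.injEq, true_and]
  funext i
  rw [List.getD_eq_getElem?_getD, List.getD_eq_getElem?_getD, List.getElem?_map]
  cases ls[(i : ℕ)]? <;> rfl

/-- `act_eq`: bookkeeping/simp lemma (act eq). -/
theorem N2.act_eq (f : N2 K r n) : f.act π = ⟨f.isAnd, fun i => (f.xs i).act π⟩ := rfl

/-- `act_n2and`: bookkeeping/simp lemma (act n2and). -/
@[simp] theorem act_n2and (xs : List (N1 K r n)) : (n2and xs).act π = n2and (xs.map (N1.act π)) := by
  simp only [n2and, N2.act_eq, N2.mk.injEq, true_and]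
  funext i
  rw [List.getD_eq_getElem?_getD, List.getD_eq_getElem?_getD, List.getElem?_map]
  cases xs[(i : ℕ)]? with
  | none => simp [act_n1and]
  | some f => rfl

/-- `act_n2or`: bookkeeping/simp lemma (act n2or). -/
@[simp] theorem act_n2or (xs : List (N1 K r n)) : (n2or xs).act π = n2or (xs.map (N1.act π)) := by
  simp only [n2or, N2.act_eq, N2.mk.injEq, true_and]
  funext i
  rw [List.getD_eq_getElem?_getD, List.getD_eq_getElem?_getD, List.getElem?_map]
  cases xs[(i : ℕ)]? with
  | none => simp [act_n1or]
  | some f => rfl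

end WCan

end Summit.PneNP.PneNP.Theorems

end
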